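/-
Copyright (c) 2026 the pub-hodgecm-mathlib formalisation cell (harness21).  Prover seat hodgecm-mathlib-K2E4-p14 (g7): Track B «K2-LIT», ENGINE E1,
h413 = stmt-HodgeConjecture-24833; DEAL (89) of K2E1-plan (g6) (filler): the `N = 2` print of ★ p859450 `K2E1ContinuedZeroConstantTermOrthogonalCMThree` (K2E4-p10 (g6)).
-/
import Summits.HodgeConjecture.HodgeConjecture.Theorems.K2E1ContinuedZeroConstantTermOrthogonalCMThree   -- ★ p859450 (K2E4-p10 g6): §1 generic `mem_cuspidalSubspace_of_ae_setIntegral_eq_zero`; brings ★ DischargeU∕DensityU (the `U(Φ₂)` data suppliers)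
import HarnessLib

/-!
# K2·E1 — `K2E1ContinuedZeroConstantTermOrthogonalCMTwo`: THE `U(Φ₂) = U(1,1)` PRINT OF THE `hcusp` DOOR — AN `L²` CLASS ON `U(Φ₂)(L⁺)∖U(Φ₂)(𝔸_{L⁺})` WHOSE CONSTANT TERMS
# ALONG THE SIEGEL RADICAL VANISH ALMOST EVERYWHERE IS CUSPIDAL

Track B ∕ K2-LIT, crux h413 = `stmt-HodgeConjecture-24833`, route of record `HCCMUnconditional`; cell `hodgecm-mathlib`, squad K2, ENGINE E1, campaign EIS-R7-BL-SPH (R31), rank `N = 2`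
(`ρ₀ = 1`).  THEOREMS ONLY (no `def`, no `instance`, no notation, no named-fact hypothesis, no `sorry`; default heartbeats); lane `--supports stmt-HodgeConjecture-24833 --as helper`
(count-neutral).  Closes no socket.  This is the `2 ↤ 3` print of ★ `K2E1ContinuedZeroConstantTermOrthogonalCMThree.mem_cmCuspidalSubspaceR_three_of_ae_constantTerm_eq_zero` (K2E4-p10 (g6)):
its §1 is generic (★ `mem_cuspidalSubspace_of_ae_setIntegral_eq_zero`, every adelic group datum with `A_G = 1`, every radical data), and every `U(Φ₂)` radical datum is ★ — `N_i(𝔸)`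
closed ★ `isClosed_cmParabolicData_radical_two`, Weil's invariant measure on `G(𝔸)∕N_i(𝔸)` ★ `exists_invariantMeasure_quotient_cmParabolicData_two`, `ν_N := haar` inversion-invariant
★ `isInvInvariant_cmParabolicData_two`, fundamental domains ★ `exists_isFundamentalDomain_cmParabolicData_two`, `N_i(L⁺)` co-compact ★ `exists_isCompact_rational_smul_mem_siegel`,
`U(Φ₂)(L⁺)` discrete ★, `A_G = 1` ★ (`cmDatum_quotientSubgroup ∕ cmDatum_arithmeticSubgroup`) — exactly as in ★ `cmCuspidalSubspace_orthogonal_eq_topologicalClosure_span_two`.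

THE MATHEMATICS ([MoeglinWaldspurger1995, II.1.2–II.1.4]; [Garrett2018, §1.8]; [BorelJacquet1979, §4.4–§4.6]).  Unfolding a square-integrable pseudo-Eisenstein series `θ_Φ` against an `L²`
class `v` gives `c_N·⟪[θ_Φ], v⟫ = c_Γ·∫_{G(𝔸)∕N(𝔸)} Φ(ỹ)·conj(CT v)(ỹ) dμ_N(ỹ)`; so if the constant terms of `v` vanish `μ_N`-a.e. then `v ⊥ [θ_Φ]` for every `Φ` in the square-integrable test
class of every radical, and `v` is cuspidal by density (★ (H2)-f).  Through this door the residue class `Res − φ₀r·𝟙` of the continued `U(1,1)` Eisenstein series (constant term zero by the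
continued constant-term identity (E3′) at `ρ₀ = 1`) enters `L²_cusp(U(Φ₂))` in the `N = 2` residue-is-constant payer ★ `K2E1SphericalEisensteinRegularRemainderCMTwoOfLetters.hres_cm_two_of_letters`.
* **`mem_cmCuspidalSubspace_two_of_ae_constantTerm_eq_zero (μ) [IsAutomorphicMeasure μ] (v : L²(μ)) (hCT)`** : `v ∈ cmCuspidalSubspace L 2 μ` — `hCT` in the trunk's «for all data» a.e. form
  (every index `i` of ★ `cmParabolicData L 2`, every Borel structure on `G(𝔸)∕N_i(𝔸)`, every Haar `ν_N` with a fundamental domain `𝓕` of `N_i(L⁺)`, every invariant `μ_N`).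
HONEST LABEL: HC_CM is proved only modulo the 7 printed citations (2 remaining named inputs: hLiu418 = `stmt-HodgeConjecture-24832`, h413 = `stmt-HodgeConjecture-24833`) until rung 0
closes; this file asserts no named fact and closes no socket; count-neutral; unconditional.

## References
* [MoeglinWaldspurger1995] C. Mœglin, J.-L. Waldspurger, *Spectral Decomposition and Eisenstein Series* (1995): II.1.2–II.1.4.
* [Garrett2018] P. Garrett, *Modern Analysis of Automorphic Forms by Example* 1 (2018): §1.8.
* [BorelJacquet1979] A. Borel, H. Jacquet, *Automorphic forms and automorphic representations*, Proc. Symp. Pure Math. 33.1 (1979): §4.4–§4.6.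
-/

set_option autoImplicit false
-- the mandated namespace repeats the single-problem summit's segment (`HodgeConjecture.HodgeConjecture`)
set_option linter.dupNamespace false

noncomputable section

open MeasureTheory Measure Set Filter Topology NumberField
open scoped ENNReal NNReal Pointwise InnerProductSpace ComplexConjugate
open Literature.MeasureTheory.Group Literature.NumberTheory.Automorphic Literature.NumberTheory.Automorphic.UnitaryGroup AdelicGroupData
open Summit.HodgeConjecture.HodgeConjecture.Cruxes.H413.K2E1CuspidalSpectrumUnitary
open Summit.HodgeConjecture.HodgeConjecture.Cruxes.H413.K2E1SiegelRadicalCocompactU2 (exists_isCompact_rational_smul_mem_siegel)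
open Summit.HodgeConjecture.HodgeConjecture.Cruxes.H413.K2E1BorelLeviU (isClosed_cmParabolicData_radical_two)
open Summit.HodgeConjecture.HodgeConjecture.Cruxes.H413.K2E1BorelLeviUDomains (exists_isFundamentalDomain_cmParabolicData_two)
open Summit.HodgeConjecture.HodgeConjecture.Cruxes.H413.K2E1PseudoEisensteinDischargeU
open Summit.HodgeConjecture.HodgeConjecture.Cruxes.H413.K2E1ContinuedZeroConstantTermOrthogonalCMThree (mem_cuspidalSubspace_of_ae_setIntegral_eq_zero)

namespace Summit.HodgeConjecture.HodgeConjecture.Cruxes.H413.K2E1ContinuedZeroConstantTermOrthogonalCMTwo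

/-! ## The `U(Φ₂)` print: every radical datum discharged -/

section CMTwo

variable (L : Type) [Field L] [NumberField L] [IsCMField L]
variable [MeasurableSpace (cmDatum L 2 (Matrix.of fun i j : Fin 2 => if i.val + j.val + 1 = 2 then (1 : L) else 0)).Adelic]
  [BorelSpace (cmDatum L 2 (Matrix.of fun i j : Fin 2 => if i.val + j.val + 1 = 2 then (1 : L) else 0)).Adelic]
  (μ : Measure (cmDatum L 2 (Matrix.of fun i j : Fin 2 => if i.val + j.val + 1 = 2 then (1 : L) else 0)).automorphicQuotient)
  [(cmDatum L 2 (Matrix.of fun i j : Fin 2 => if i.val + j.val + 1 = 2 then (1 : L) else 0)).IsAutomorphicMeasure μ]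

/-- **`U(Φ₂)`: AN `L²` CLASS WITH VANISHING CONSTANT TERMS ALONG THE SIEGEL RADICAL IS CUSPIDAL — `v ∈ cmCuspidalSubspace L 2 μ`.**  Hypothesis, in the trunk's «for all data» a.e.
form: for every index `i` of ★ `cmParabolicData L 2`, every Borel structure making the quotient `G(𝔸)∕N_i(𝔸)` a Borel space, every Haar measure `ν_N` on `N_i(𝔸)` with a fundamental
domain `𝓕` of `N_i(L⁺)`, and every `G(𝔸)`-invariant measure `μ_N` on `G(𝔸)∕N_i(𝔸)`, the constant terms `∫_𝓕 v([ỹ u⁻¹]) dν_N(u)` of (the representative of) `v` vanish for `μ_N`-a.e. `ỹ`.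
All radical data (closed, unimodular, co-compact abelian Siegel radical ★; Weil's invariant `μ_N` ★ `exists_invariantMeasure_quotient_cmParabolicData_two`; fundamental domains ★; `A_G = 1` ★)
are discharged exactly as in ★ `cmCuspidalSubspace_orthogonal_eq_topologicalClosure_span_two`; the assembly is ★ p859450's generic §1.  This is the door through which the `N = 2`
residue-is-constant payer's letter `hcusp` is paid from the continued constant-term identity. [cite: MoeglinWaldspurger1995, II.1.2–II.1.4] [cite: BorelJacquet1979, §4.4–§4.6] -/
theorem mem_cmCuspidalSubspace_two_of_ae_constantTerm_eq_zero
    (v : (cmDatum L 2 (Matrix.of fun i j : Fin 2 => if i.val + j.val + 1 = 2 then (1 : L) else 0)).L2 μ)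
    (hCT : ∀ (i : (cmParabolicData L 2).ι)
      [MeasurableSpace ((cmDatum L 2 (Matrix.of fun i j : Fin 2 => if i.val + j.val + 1 = 2 then (1 : L) else 0)).Adelic ⧸ (cmParabolicData L 2).radical i)]
      [BorelSpace ((cmDatum L 2 (Matrix.of fun i j : Fin 2 => if i.val + j.val + 1 = 2 then (1 : L) else 0)).Adelic ⧸ (cmParabolicData L 2).radical i)]
      (νN : Measure ((cmParabolicData L 2).radical i)) [IsHaarMeasure νN]
      (𝓕 : Set ((cmParabolicData L 2).radical i)), IsFundamentalDomain ((cmParabolicData L 2).rational i) 𝓕 νN →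
      ∀ (μN : Measure ((cmDatum L 2 (Matrix.of fun i j : Fin 2 => if i.val + j.val + 1 = 2 then (1 : L) else 0)).Adelic ⧸ (cmParabolicData L 2).radical i))
        [SMulInvariantMeasure (cmDatum L 2 (Matrix.of fun i j : Fin 2 => if i.val + j.val + 1 = 2 then (1 : L) else 0)).Adelic
          ((cmDatum L 2 (Matrix.of fun i j : Fin 2 => if i.val + j.val + 1 = 2 then (1 : L) else 0)).Adelic ⧸ (cmParabolicData L 2).radical i) μN],
        ∀ᵐ y ∂μN, ∫ u in 𝓕, (v : (cmDatum L 2 (Matrix.of fun i j : Fin 2 => if i.val + j.val + 1 = 2 then (1 : L) else 0)).automorphicQuotient → ℂ)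
          ((cmDatum L 2 (Matrix.of fun i j : Fin 2 => if i.val + j.val + 1 = 2 then (1 : L) else 0)).toAutomorphicQuotient
            (y.out * (u : (cmDatum L 2 (Matrix.of fun i j : Fin 2 => if i.val + j.val + 1 = 2 then (1 : L) else 0)).Adelic)⁻¹)) ∂νN = 0) :
    v ∈ cmCuspidalSubspace L 2 μ := by
  haveI := discreteTopology_cmDatum_quotientSubgroup L 2 (Matrix.of fun i j : Fin 2 => if i.val + j.val + 1 = 2 then (1 : L) else 0)
  haveI : ∀ i, IsClosed (((cmParabolicData L 2).radical i : Subgroup (cmDatum L 2 (Matrix.of fun i j : Fin 2 => if i.val + j.val + 1 = 2 then (1 : L) else 0)).Adelic) :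
      Set (cmDatum L 2 (Matrix.of fun i j : Fin 2 => if i.val + j.val + 1 = 2 then (1 : L) else 0)).Adelic) := fun i => isClosed_cmParabolicData_radical_two L i
  haveI : ∀ i, LocallyCompactSpace ((cmParabolicData L 2).radical i) := fun i => (isClosed_cmParabolicData_radical_two L i).locallyCompactSpace
  haveI : ∀ i, SecondCountableTopology ((cmParabolicData L 2).radical i) := fun i => TopologicalSpace.Subtype.secondCountableTopology _
  letI : ∀ i, MeasurableSpace ((cmDatum L 2 (Matrix.of fun i j : Fin 2 => if i.val + j.val + 1 = 2 then (1 : L) else 0)).Adelic ⧸ (cmParabolicData L 2).radical i) := fun i => borel _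
  haveI : ∀ i, BorelSpace ((cmDatum L 2 (Matrix.of fun i j : Fin 2 => if i.val + j.val + 1 = 2 then (1 : L) else 0)).Adelic ⧸ (cmParabolicData L 2).radical i) := fun i => ⟨rfl⟩
  have hμN := fun i => exists_invariantMeasure_quotient_cmParabolicData_two L i
  choose μN hμN hμNc hμNo using hμN
  haveI := hμN; haveI := hμNc; haveI := hμNo
  obtain ⟨νN, hνN⟩ : ∃ νN : ∀ i, Measure ((cmParabolicData L 2).radical i), ∀ i, IsHaarMeasure (νN i) ∧ (νN i).IsInvInvariant :=
    ⟨fun i => haar, fun i => ⟨inferInstance, isInvInvariant_cmParabolicData_two L i haar⟩⟩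
  haveI : ∀ i, IsHaarMeasure (νN i) := fun i => (hνN i).1
  haveI : ∀ i, (νN i).IsInvInvariant := fun i => (hνN i).2
  haveI : ∀ i, SigmaFinite (νN i) := fun i => by infer_instance
  have hcpt : ∀ i : (cmParabolicData L 2).ι, ∃ C : Set ((cmParabolicData L 2).radical i), IsCompact C ∧ ∀ u : (cmParabolicData L 2).radical i, ∃ l : (cmParabolicData L 2).rational i, l • u ∈ C := by
    intro i
    obtain ⟨k, hk⟩ := i
    obtain rfl : k = 1 := by omega
    exact exists_isCompact_rational_smul_mem_siegel L (antidiagOne_eq_over (L := L) (N := 2)).symm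
  have h𝓕 := fun i => exists_isFundamentalDomain_cmParabolicData_two L i (νN i)
  choose 𝓕 h𝓕 _h𝓕 using h𝓕
  have hQ : (cmDatum L 2 (Matrix.of fun i j : Fin 2 => if i.val + j.val + 1 = 2 then (1 : L) else 0)).quotientSubgroup =
      (cmDatum L 2 (Matrix.of fun i j : Fin 2 => if i.val + j.val + 1 = 2 then (1 : L) else 0)).arithmeticSubgroup :=
    (cmDatum_quotientSubgroup L 2 _).trans (cmDatum_arithmeticSubgroup L 2 _).symm
  exact mem_cuspidalSubspace_of_ae_setIntegral_eq_zero _ hQ (cmParabolicData L 2) μ μN νN hcpt h𝓕 v fun i => hCT i (νN i) (𝓕 i) (h𝓕 i) (μN i)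

end CMTwo

end Summit.HodgeConjecture.HodgeConjecture.Cruxes.H413.K2E1ContinuedZeroConstantTermOrthogonalCMTwo

end
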